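import Summits.RiemannHypothesis.RiemannHypothesis.Theorems.WeilGroundStateGroundStatesConvergeToXiStubPhiConvHarmonic
import Summits.RiemannHypothesis.RiemannHypothesis.Theorems.WeilGroundStateGroundStatesConvergeToXiStubZeroSideTruncation
import Literature.NumberTheory.LFunctions.WeilExplicit
import Literature.NumberTheory.LFunctions.WeilExplicitProofs
import Mathlib.Analysis.Calculus.ParametricIntegral
import Mathlib.Analysis.Calculus.IteratedDeriv.Lemmas
import Mathlib.Analysis.Convolution
import Mathlib.MeasureTheory.Integral.Prod
import HarnessLib

/-!
# `WeilGroundState.GroundStatesConvergeToXi` — pairing a weighted-`L¹` function with the strong class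
(crux item stmt-RiemannHypothesis-1527, route route-RiemannHypothesis-WeilGroundState; line `Sketch`,
stub `stub_strongClass_pairing` (K1); `--supports`)

Let `v : ℝ → ℂ` be a.e.-strongly measurable with `∫ ‖v(t)‖ e^{b₁|t|} dt < ∞` (`b₁ > 1/2`) and let
`h` lie in the STRONG EXPONENTIAL WEIL CLASS with rate `b₀ ∈ (1/2, b₁]`: `h` smooth with
`‖h^{(k)}(t)‖ ≤ C_k e^{-b₀|t|}` for every `k`.  Then `F = v ⋆ h̃` (`h̃ = weilReflect h`,
`h̃(t) = conj h(-t)`, which lies in the same strong class since `‖h̃^{(k)}(t)‖ = ‖h^{(k)}(-t)‖`)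
satisfies:
* `F` is smooth with `F^{(k)} = v ⋆ h̃^{(k)}` (differentiation under the integral sign,
  `hasDerivAt_integral_of_dominated_loc_of_deriv_le`, majorant `sup ‖k'‖ · ‖v‖`, `v ∈ L¹`);
* `‖(v ⋆ k)(t)‖ ≤ (C ∫ ‖v‖ e^{b₁|u|} du) e^{-b₀|t|}` whenever `‖k‖ ≤ C e^{-b₀|·|}`, from
  `e^{-b₀|t-u|} ≤ e^{-b₀|t|} e^{b₀|u|} ≤ e^{-b₀|t|} e^{b₁|u|}`; with `k = h̃^{(k)}` this is the
  all-orders envelope of `F`;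
* `F̂(s) = v̂(s) · conj ĥ(1 - conj s)` for `0 ≤ Re s ≤ 1`: with `c = s - 1/2`,
  `F(t) e^{ct} = ((v e^{c·}) ⋆ (h̃ e^{c·}))(t)` pointwise, both factors are integrable in the closed
  strip (`|Re c| ≤ 1/2 < b₀ ≤ b₁`), and `∫ (G ⋆ H) = (∫ G)(∫ H)`
  (`MeasureTheory.integral_convolution`); finally `weilMellin_weilReflect_holds`.

No new definitions; no named fact is used.
-/

noncomputable section

set_option linter.dupNamespace false

open scoped Topology Real ComplexConjugate Convolution
open Filter Set MeasureTheory Complex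

namespace Summit.RiemannHypothesis.RiemannHypothesis.Theorems.GroundStatesConvergeToXi

open Literature.NumberTheory.LFunctions

/-! ## Weighted `L¹` functions are `L¹` -/

/-- If `∫ ‖v‖ e^{b₁|t|} < ∞` with `b₁ ≥ 0` and `v` is a.e.-strongly measurable, then `v ∈ L¹`
(`e^{b₁|t|} ≥ 1`). [folklore] -/
theorem scPair_integrable {v : ℝ → ℂ} {b₁ : ℝ} (hv : AEStronglyMeasurable v volume) (hb₁ : 0 ≤ b₁)
    (hint : Integrable (fun t : ℝ => ‖v t‖ * Real.exp (b₁ * |t|))) : Integrable v :=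
  hint.mono' hv (ae_of_all _ fun t =>
    le_mul_of_one_le_right (norm_nonneg _) (Real.one_le_exp (by positivity)))

/-! ## Differentiation under the integral sign -/

/-- **Derivative of `v ⋆ k` for `v ∈ L¹` and `k ∈ C¹_b`.** If `k` is differentiable with `k` and
`k'` bounded (`k'` continuous), then `(v ⋆ k)' (t) = (v ⋆ k')(t)`
(`hasDerivAt_integral_of_dominated_loc_of_deriv_le` with the integrable majorant `sup ‖k'‖ · ‖v‖`).
[folklore] -/
theorem scPair_hasDerivAt {v k : ℝ → ℂ} (hvi : Integrable v) (hk : Differentiable ℝ k)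
    (hkc : Continuous (deriv k)) {B₀ B₁ : ℝ} (hB₀ : ∀ x, ‖k x‖ ≤ B₀)
    (hB₁ : ∀ x, ‖deriv k x‖ ≤ B₁) (t : ℝ) :
    HasDerivAt (weilConv v k) (weilConv v (deriv k) t) t := by
  have e1 : weilConv v k = fun x => ∫ u, v u * k (x - u) := funext (weilConv_apply v k)
  rw [e1, weilConv_apply]
  have hv : AEStronglyMeasurable v volume := hvi.aestronglyMeasurable
  have hm : ∀ x : ℝ, AEStronglyMeasurable (fun u : ℝ => v u * k (x - u)) volume := fun x =>
    hv.mul (hk.continuous.comp (continuous_const.sub continuous_id)).aestronglyMeasurable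
  have hm' : AEStronglyMeasurable (fun u : ℝ => v u * deriv k (t - u)) volume :=
    hv.mul (hkc.comp (continuous_const.sub continuous_id)).aestronglyMeasurable
  have key := hasDerivAt_integral_of_dominated_loc_of_deriv_le (μ := volume)
    (F := fun x u => v u * k (x - u)) (F' := fun x u => v u * deriv k (x - u)) (x₀ := t)
    (s := univ) (bound := fun u => B₁ * ‖v u‖) Filter.univ_mem (Eventually.of_forall hm)
    (hvi.mul_bdd (hk.continuous.comp (continuous_const.sub continuous_id)).aestronglyMeasurable
      (ae_of_all _ fun u => hB₀ _))
    hm'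
    (ae_of_all _ fun u x _ => by
      rw [norm_mul, mul_comm]
      exact mul_le_mul_of_nonneg_right (hB₁ _) (norm_nonneg _))
    (hvi.norm.const_mul B₁)
    (ae_of_all _ fun u x _ => ((hk (x - u)).hasDerivAt.comp_sub_const x u).const_mul (v u))
  exact key.2

/-- **Iterated derivatives of `v ⋆ k`.** For `v ∈ L¹` and `k` smooth with every derivative
bounded, `(v ⋆ k)^{(n)} = v ⋆ k^{(n)}` (induction on `n` with `scPair_hasDerivAt`). [folklore] -/
theorem scPair_iteratedDeriv_eq {v k : ℝ → ℂ} (hvi : Integrable v) (hk : ContDiff ℝ (⊤ : ℕ∞) k)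
    (hbd : ∀ n : ℕ, ∃ B : ℝ, ∀ x, ‖iteratedDeriv n k x‖ ≤ B) (n : ℕ) :
    iteratedDeriv n (weilConv v k) = weilConv v (iteratedDeriv n k) := by
  induction n with
  | zero => simp only [iteratedDeriv_zero]
  | succ n ih =>
    obtain ⟨B₀, hB₀⟩ := hbd n
    obtain ⟨B₁, hB₁⟩ := hbd (n + 1)
    have hdiff : Differentiable ℝ (iteratedDeriv n k) :=
      hk.differentiable_iteratedDeriv n (by exact_mod_cast WithTop.coe_lt_coe.mpr (ENat.coe_lt_top n))
    have hcont : Continuous (deriv (iteratedDeriv n k)) := by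
      rw [← iteratedDeriv_succ]
      exact hk.continuous_iteratedDeriv (n + 1) (by exact_mod_cast le_top)
    have hB₁' : ∀ x, ‖deriv (iteratedDeriv n k) x‖ ≤ B₁ := fun x => by
      rw [← iteratedDeriv_succ]; exact hB₁ x
    rw [iteratedDeriv_succ, ih, iteratedDeriv_succ]
    funext t
    exact (scPair_hasDerivAt hvi hdiff hcont hB₀ hB₁' t).deriv

/-- **`v ⋆ k` is smooth** for `v ∈ L¹` and `k` smooth with every derivative bounded
(`contDiff_of_differentiable_iteratedDeriv`). [folklore] -/
theorem scPair_contDiff {v k : ℝ → ℂ} (hvi : Integrable v) (hk : ContDiff ℝ (⊤ : ℕ∞) k)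
    (hbd : ∀ n : ℕ, ∃ B : ℝ, ∀ x, ‖iteratedDeriv n k x‖ ≤ B) :
    ContDiff ℝ (⊤ : ℕ∞) (weilConv v k) := by
  refine contDiff_of_differentiable_iteratedDeriv fun m _ => ?_
  rw [scPair_iteratedDeriv_eq hvi hk hbd m]
  obtain ⟨B₀, hB₀⟩ := hbd m
  obtain ⟨B₁, hB₁⟩ := hbd (m + 1)
  have hdiff : Differentiable ℝ (iteratedDeriv m k) :=
    hk.differentiable_iteratedDeriv m (by exact_mod_cast WithTop.coe_lt_coe.mpr (ENat.coe_lt_top m))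
  have hcont : Continuous (deriv (iteratedDeriv m k)) := by
    rw [← iteratedDeriv_succ]
    exact hk.continuous_iteratedDeriv (m + 1) (by exact_mod_cast le_top)
  have hB₁' : ∀ x, ‖deriv (iteratedDeriv m k) x‖ ≤ B₁ := fun x => by
    rw [← iteratedDeriv_succ]; exact hB₁ x
  exact fun t => (scPair_hasDerivAt hvi hdiff hcont hB₀ hB₁' t).differentiableAt

/-! ## The weighted pointwise bound -/

/-- **Class bound of `v ⋆ k`.** If `∫ ‖v‖ e^{b₁|u|} < ∞` and `‖k(x)‖ ≤ C e^{-b₀|x|}` with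
`0 ≤ b₀ ≤ b₁`, then `‖(v ⋆ k)(t)‖ ≤ (max C 0 · ∫ ‖v‖ e^{b₁|u|}) e^{-b₀|t|}`, since
`-b₀|t - u| ≤ -b₀|t| + b₀|u| ≤ -b₀|t| + b₁|u|`. [folklore] -/
theorem scPair_norm_weilConv_le {v k : ℝ → ℂ} {b₁ b₀ C : ℝ}
    (hint : Integrable (fun t : ℝ => ‖v t‖ * Real.exp (b₁ * |t|))) (hb₀ : 0 ≤ b₀) (hle : b₀ ≤ b₁)
    (hC : ∀ x, ‖k x‖ ≤ C * Real.exp (-(b₀ * |x|))) (t : ℝ) :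
    ‖weilConv v k t‖ ≤
      (max C 0 * ∫ u, ‖v u‖ * Real.exp (b₁ * |u|)) * Real.exp (-(b₀ * |t|)) := by
  rw [weilConv_apply]
  have hpt : ∀ u : ℝ, ‖v u * k (t - u)‖ ≤
      max C 0 * Real.exp (-(b₀ * |t|)) * (‖v u‖ * Real.exp (b₁ * |u|)) := by
    intro u
    rw [norm_mul]
    have h1 : ‖k (t - u)‖ ≤ max C 0 * Real.exp (-(b₀ * |t - u|)) :=
      (hC _).trans (mul_le_mul_of_nonneg_right (le_max_left _ _) (Real.exp_pos _).le)
    have h2 : Real.exp (-(b₀ * |t - u|)) ≤ Real.exp (-(b₀ * |t|)) * Real.exp (b₁ * |u|) := by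
      rw [← Real.exp_add, Real.exp_le_exp]
      have h3 := mul_le_mul_of_nonneg_left (abs_sub_abs_le_abs_sub t u) hb₀
      have h4 : b₀ * |u| ≤ b₁ * |u| := mul_le_mul_of_nonneg_right hle (abs_nonneg u)
      nlinarith
    calc ‖v u‖ * ‖k (t - u)‖
        ≤ ‖v u‖ * (max C 0 * (Real.exp (-(b₀ * |t|)) * Real.exp (b₁ * |u|))) :=
          mul_le_mul_of_nonneg_left
            (h1.trans (mul_le_mul_of_nonneg_left h2 (le_max_right _ _))) (norm_nonneg _)
      _ = max C 0 * Real.exp (-(b₀ * |t|)) * (‖v u‖ * Real.exp (b₁ * |u|)) := by ring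
  calc ‖∫ u, v u * k (t - u)‖ ≤ ∫ u, ‖v u * k (t - u)‖ := norm_integral_le_integral_norm _
    _ ≤ ∫ u, max C 0 * Real.exp (-(b₀ * |t|)) * (‖v u‖ * Real.exp (b₁ * |u|)) :=
        integral_mono_of_nonneg (ae_of_all _ fun u => norm_nonneg _) (hint.const_mul _)
          (ae_of_all _ hpt)
    _ = (max C 0 * ∫ u, ‖v u‖ * Real.exp (b₁ * |u|)) * Real.exp (-(b₀ * |t|)) := by
        rw [integral_const_mul]; ring

/-! ## The reflection `h̃` stays in the strong class -/

/-- `h̃ = conj ∘ h ∘ (-·)` is smooth if `h` is. [folklore] -/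
theorem scPair_contDiff_weilReflect {h : ℝ → ℂ} (hh : ContDiff ℝ (⊤ : ℕ∞) h) :
    ContDiff ℝ (⊤ : ℕ∞) (weilReflect h) :=
  ContDiff.comp Complex.conjCLE.contDiff (ContDiff.comp hh contDiff_neg)

/-- `‖h̃^{(n)}(t)‖ = ‖h^{(n)}(-t)‖`: `conj` is a real linear isometry
(`LinearIsometryEquiv.norm_iteratedFDeriv_comp_left`) and `(h ∘ (-·))^{(n)}(t) = (-1)^n h^{(n)}(-t)`
(`iteratedDeriv_comp_neg`). [folklore] -/
theorem scPair_norm_iteratedDeriv_weilReflect (h : ℝ → ℂ) (n : ℕ) (t : ℝ) :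
    ‖iteratedDeriv n (weilReflect h) t‖ = ‖iteratedDeriv n h (-t)‖ := by
  have e : weilReflect h = Complex.conjLIE ∘ fun x : ℝ => h (-x) := rfl
  rw [← norm_iteratedFDeriv_eq_norm_iteratedDeriv, e,
    LinearIsometryEquiv.norm_iteratedFDeriv_comp_left, norm_iteratedFDeriv_eq_norm_iteratedDeriv,
    iteratedDeriv_comp_neg, norm_smul, norm_pow, norm_neg, norm_one, one_pow, one_mul]

/-! ## The transform of `v ⋆ h̃` in the closed strip -/

/-- **`(v ⋆ h̃)^(s) = v̂(s) · conj ĥ(1 - conj s)`** for `0 ≤ Re s ≤ 1`, `∫ ‖v‖ e^{b₁|t|} < ∞`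
(`b₁ > 1/2`) and continuous `h` with `‖h‖ ≤ C e^{-b₀|·|}` (`b₀ > 1/2`): with `c = s - 1/2`,
`(v ⋆ h̃)(t) e^{ct} = ((v e^{c·}) ⋆ (h̃ e^{c·}))(t)`, both factors integrable, and
`∫ (G ⋆ H) = (∫ G)(∫ H)` (`MeasureTheory.integral_convolution`); then
`weilMellin_weilReflect_holds`. [folklore] -/
theorem scPair_weilMellin {v h : ℝ → ℂ} {b₁ b₀ C : ℝ} (hv : AEStronglyMeasurable v volume)
    (hb₁ : 1 / 2 < b₁) (hint : Integrable (fun t : ℝ => ‖v t‖ * Real.exp (b₁ * |t|)))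
    (hhc : Continuous h) (hb₀ : 1 / 2 < b₀) (hC : ∀ x, ‖h x‖ ≤ C * Real.exp (-(b₀ * |x|)))
    {s : ℂ} (hs0 : 0 ≤ s.re) (hs1 : s.re ≤ 1) :
    weilMellin (weilConv v (weilReflect h)) s =
      weilMellin v s * conj (weilMellin h (1 - conj s)) := by
  rw [← weilMellin_weilReflect_holds]
  set c : ℂ := s - 1 / 2 with hc
  set G : ℝ → ℂ := fun u => v u * cexp (c * u) with hG
  set H : ℝ → ℂ := fun u => weilReflect h u * cexp (c * u) with hH
  have hGi : Integrable G := by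
    refine hint.mono' (hv.mul (Continuous.aestronglyMeasurable (by fun_prop)))
      (ae_of_all _ fun u => ?_)
    simp only [hG]
    rw [norm_mul, Complex.norm_exp]
    have hre : (c * (u : ℂ)).re = (s.re - 1 / 2) * u := by
      simp [hc, sub_re, mul_re]
    rw [hre]
    refine mul_le_mul_of_nonneg_left (Real.exp_le_exp.2 ?_) (norm_nonneg _)
    have h1 : |s.re - 1 / 2| ≤ 1 / 2 := abs_le.2 ⟨by linarith, by linarith⟩
    calc (s.re - 1 / 2) * u ≤ |(s.re - 1 / 2) * u| := le_abs_self _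
      _ = |s.re - 1 / 2| * |u| := abs_mul _ _
      _ ≤ b₁ * |u| := mul_le_mul_of_nonneg_right (by linarith) (abs_nonneg _)
  have hrc : Continuous (weilReflect h) := (hhc.comp continuous_neg).star
  have hrC : ∀ x, ‖weilReflect h x‖ ≤ C * Real.exp (-(b₀ * |x|)) := fun x => by
    simpa only [weilReflect, Complex.norm_conj, abs_neg] using hC (-x)
  have hHi : Integrable H := zsTrunc_integrable_mul_cexp hrc hb₀ hrC hs0 hs1
  have key : ∀ t : ℝ,
      weilConv v (weilReflect h) t * cexp (c * t) = (G ⋆[ContinuousLinearMap.mul ℂ ℂ] H) t := by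
    intro t
    rw [weilConv_apply, convolution_def, ← integral_mul_const]
    congr 1 with u
    simp only [hG, hH, ContinuousLinearMap.mul_apply']
    have he : cexp (c * t) = cexp (c * u) * cexp (c * ((t - u : ℝ) : ℂ)) := by
      rw [← Complex.exp_add]
      push_cast
      ring_nf
    rw [he]
    ring
  have hL : weilMellin (weilConv v (weilReflect h)) s =
      ∫ t : ℝ, (G ⋆[ContinuousLinearMap.mul ℂ ℂ] H) t := by
    unfold weilMellin
    exact integral_congr_ae (Eventually.of_forall fun t => key t)
  rw [hL, integral_convolution (ContinuousLinearMap.mul ℂ ℂ) hGi hHi,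
    ContinuousLinearMap.mul_apply']
  rfl

/-! ## The stub -/

/-- **Stub K1 — `strongClass_pairing` (RH-free).**  For `v` with `∫‖v‖e^{b₁|t|} < ∞` (`b₁ > 1/2`,
`v` a.e.-strongly measurable) and `h` in the strong class with rate `b₀ ∈ (1/2, b₁]` (smooth, all
derivatives `O(e^{-b₀|t|})`), the convolution `v ⋆ h̃` is smooth with all derivatives
`(v ⋆ h̃)^{(k)} = v ⋆ h̃^{(k)} = O(e^{−b₀|t|})` (differentiation under the integral sign;
`e^{−b₀|t−u|} ≤ e^{−b₀|t|}e^{b₁|u|}`), and its transform in the closed strip is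
`v̂(s) · conj ĥ(1 − conj s)` (Fubini, `MeasureTheory.integral_convolution`). [folklore] -/
theorem stub_strongClass_pairing :
    ∀ (v h : ℝ → ℂ) (b₁ b₀ : ℝ), AEStronglyMeasurable v volume → 1 / 2 < b₁ →
      Integrable (fun t : ℝ => ‖v t‖ * Real.exp (b₁ * |t|)) →
      ContDiff ℝ (⊤ : ℕ∞) h → 1 / 2 < b₀ → b₀ ≤ b₁ →
      (∀ k : ℕ, ∃ C : ℝ, ∀ t : ℝ, ‖iteratedDeriv k h t‖ ≤ C * Real.exp (-(b₀ * |t|))) →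
      ContDiff ℝ (⊤ : ℕ∞) (weilConv v (weilReflect h)) ∧
      (∀ k : ℕ, ∃ C : ℝ, ∀ t : ℝ,
        ‖iteratedDeriv k (weilConv v (weilReflect h)) t‖ ≤ C * Real.exp (-(b₀ * |t|))) ∧
      ∀ s : ℂ, 0 ≤ s.re → s.re ≤ 1 →
        weilMellin (weilConv v (weilReflect h)) s =
          weilMellin v s * (starRingEnd ℂ) (weilMellin h (1 - (starRingEnd ℂ) s)) := by
  intro v h b₁ b₀ hv hb₁ hint hh hb₀ hle hbd
  have hb₀' : 0 ≤ b₀ := by linarith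
  have hvi : Integrable v := scPair_integrable hv (by linarith) hint
  have hrc : ContDiff ℝ (⊤ : ℕ∞) (weilReflect h) := scPair_contDiff_weilReflect hh
  have hrb : ∀ k : ℕ, ∃ C : ℝ, ∀ t : ℝ,
      ‖iteratedDeriv k (weilReflect h) t‖ ≤ C * Real.exp (-(b₀ * |t|)) := by
    intro k
    obtain ⟨C, hC⟩ := hbd k
    refine ⟨C, fun t => ?_⟩
    rw [scPair_norm_iteratedDeriv_weilReflect]
    simpa only [abs_neg] using hC (-t)
  have hrb' : ∀ n : ℕ, ∃ B : ℝ, ∀ x, ‖iteratedDeriv n (weilReflect h) x‖ ≤ B := by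
    intro n
    obtain ⟨C, hC⟩ := hrb n
    refine ⟨max C 0, fun x => (hC x).trans ?_⟩
    have h1 : C * Real.exp (-(b₀ * |x|)) ≤ max C 0 * Real.exp (-(b₀ * |x|)) :=
      mul_le_mul_of_nonneg_right (le_max_left C 0) (Real.exp_pos _).le
    refine h1.trans (mul_le_of_le_one_right (le_max_right C 0) (Real.exp_le_one_iff.2 ?_))
    exact neg_nonpos.2 (mul_nonneg hb₀' (abs_nonneg x))
  refine ⟨scPair_contDiff hvi hrc hrb', fun k => ?_, fun s hs0 hs1 => ?_⟩
  · obtain ⟨C, hC⟩ := hrb k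
    refine ⟨max C 0 * ∫ u, ‖v u‖ * Real.exp (b₁ * |u|), fun t => ?_⟩
    rw [scPair_iteratedDeriv_eq hvi hrc hrb' k]
    exact scPair_norm_weilConv_le hint hb₀' hle hC t
  · obtain ⟨C, hC⟩ := hbd 0
    exact scPair_weilMellin hv hb₁ hint hh.continuous hb₀
      (fun x => by simpa only [iteratedDeriv_zero] using hC x) hs0 hs1

end Summit.RiemannHypothesis.RiemannHypothesis.Theorems.GroundStatesConvergeToXi

end
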